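import Literature.Topology.FourManifolds.LefschetzHandlebody
import HarnessLib

/-!
# Angle bookkeeping of one signed Hurwitz move (three drags of a handle through free sectors)
(wave 6, brick of stub `stub_M2geo` = node N1 of NF4, line `modp-braid-orbits`, crux
`ConvexBisection.AcyclicBisectionExists`, item stmt-SmoothPoincare4-10508; registered sub-goal
`helper_exists_int_of_pageDir_eq`)

The N1 design (`N1_HurwitzMove_Design.lean`, worker G4) realises one signed Hurwitz move at the
positions `i`, `i+1` of a Lefschetz link over `Base g` (directions `pageDir n k = e^{−2πi(k+½)/n}`,
clockwise in `k`) by THREE drags of one handle through a sector of pages (`node_N1_move`):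
for disjunct 1 of `HurwitzStep` (`up`), handle `i+1` is dragged counter-clockwise by `3π/n`
(crossing the belt page of handle `i` at parameter `2/3` of the arc, and nothing else), then
handle `i` clockwise by `2π/n` (free), then handle `i+1` clockwise by `π/n` (free); for disjunct
2 (`¬up`) the mirror images.  The drag node asks that the closed swept arc
`t ↦ d k₀ e^{itφ}`, `t ∈ [0,1]`, contain no other handle direction (except the crossed one, strictly
inside).  This file is that bookkeeping, pure trigonometry of `pageDir`:

Contents: `exp_mul_I_eq_iff`, `pageDir_mul_exp_ofReal`, `exists_int_of_pageDir_eq` (registered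
`helper_exists_int_of_pageDir_eq`: `pageDir n k = e^{i(θ_j + c)}` reads `c n / 2π = j − k − n m`),
the freeness of the three arcs (`free_move*`), the crossed direction at `t = 2/3` (`cross_move1`),
the final directions (`dir_move2`, `dir_move3`), and the primed mirrors for disjunct 2.
Everything here is proved; no named facts, no `sorry`.  Reference for the move:
R. E. Gompf, A. I. Stipsicz, *4-Manifolds and Kirby Calculus* (1999), §8.2 [GompfStipsicz1999].
-/

noncomputable section

set_option linter.dupNamespace false

open scoped Real
open Set Function

namespace Summit.SmoothPoincare4.SmoothPoincare4.Theorems.AcyclicBisectionExists.ModpBraidOrbits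

open Literature.Topology.FourManifolds.LefschetzBase

namespace HurwitzMove

/-- `pageDir` shifted by an angle. [folklore] -/
theorem pageDir_mul_exp_ofReal (n k : ℕ) (c : ℝ) :
    pageDir n k * Complex.exp ((c : ℂ) * Complex.I) =
      Complex.exp (((-(2 * π * (k + 1 / 2) / n) + c : ℝ) : ℂ) * Complex.I) := by
  rw [pageDir, ← Complex.exp_add]
  congr 1; push_cast; ring

/-- `e^{ia} = e^{ib}` iff `a ≡ b (mod 2π)` (real `a`, `b`). [folklore] -/
theorem exp_mul_I_eq_iff {a b : ℝ} :
    Complex.exp ((a : ℂ) * Complex.I) = Complex.exp ((b : ℂ) * Complex.I) ↔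
      ∃ m : ℤ, a = b + m * (2 * π) := by
  rw [Complex.exp_eq_exp_iff_exists_int]
  constructor
  · rintro ⟨m, hm⟩
    refine ⟨m, ?_⟩
    have := congrArg Complex.im hm
    simpa using this
  · rintro ⟨m, hm⟩
    refine ⟨m, ?_⟩
    rw [hm]
    push_cast
    ring

/-- `pageDir n k = e^{i(θ_j + c)}` reads `c n / 2π = j − k − n m`, `m ∈ ℤ`. [folklore] -/
theorem exists_int_of_pageDir_eq {n : ℕ} (hn : 0 < n) (k j : ℕ) (c : ℝ)
    (h : pageDir n k = Complex.exp (((-(2 * π * (j + 1 / 2) / n) + c : ℝ) : ℂ) * Complex.I)) :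
    ∃ m : ℤ, c * n / (2 * π) = (j : ℝ) - k - n * m := by
  rw [pageDir, exp_mul_I_eq_iff] at h
  obtain ⟨m, hm⟩ := h
  refine ⟨m, ?_⟩
  have hn' : (n : ℝ) ≠ 0 := by exact_mod_cast hn.ne'
  have hπ : (π : ℝ) ≠ 0 := Real.pi_ne_zero
  field_simp
  field_simp at hm
  linarith

/-- `n m = d` with `|d| < n` forces `m = 0`. [folklore] -/
theorem int_eq_zero_of_mul_eq {n : ℕ} {m d : ℤ} (h : (n : ℤ) * m = d) (h₁ : -(n : ℤ) < d)
    (h₂ : d < n) : m = 0 := by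
  rcases lt_trichotomy m 0 with hm | hm | hm
  · nlinarith
  · exact hm
  · nlinarith

/-- `n m = 1` resp. `= −1` is impossible for `n ≥ 2`. [folklore] -/
theorem int_mul_ne_of_two_le {n : ℕ} (hn : 2 ≤ n) (m : ℤ) (u : ℤ) (hu : u = 1 ∨ u = -1) :
    (n : ℤ) * m ≠ u := by
  intro h
  have hn' : (2 : ℤ) ≤ n := by exact_mod_cast hn
  rcases lt_trichotomy m 0 with hm | hm | hm
  · rcases hu with rfl | rfl <;> nlinarith
  · subst hm; rcases hu with rfl | rfl <;> simp at h
  · rcases hu with rfl | rfl <;> nlinarith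

/-- An integer in `(0, 2)` (real bounds) is `1`. [folklore] -/
theorem int_eq_one_of {P : ℤ} (h0 : (0 : ℝ) < P) (h1 : (P : ℝ) < 2) : P = 1 := by
  have h0' : 0 < P := by exact_mod_cast h0
  have h1' : P < 2 := by exact_mod_cast h1
  omega

/-- An integer in `(−2, 0)` (real bounds) is `−1`. [folklore] -/
theorem int_eq_neg_one_of {P : ℤ} (h0 : (-2 : ℝ) < P) (h1 : (P : ℝ) < 0) : P = -1 := by
  have h0' : -2 < P := by exact_mod_cast h0
  have h1' : P < 0 := by exact_mod_cast h1
  omega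

/-- An integer in `[0, 2)` (real bounds) is `0` or `1`. [folklore] -/
theorem int_zero_or_one {J : ℤ} (h0 : (0 : ℝ) ≤ J) (h1 : (J : ℝ) < 2) : J = 0 ∨ J = 1 := by
  have h0' : 0 ≤ J := by exact_mod_cast h0
  have h1' : J < 2 := by exact_mod_cast h1
  omega

variable {n i : ℕ}

/-- Move 1 (`up`): the arc from `pageDir n (i+1)` counter-clockwise by `3π/n` is free. [folklore] -/
theorem free_move1 (hi : i + 1 < n) (k : Fin n) (hkB : k ≠ ⟨i + 1, hi⟩)
    (hkA : k ≠ ⟨i, Nat.lt_of_succ_lt hi⟩) {t : ℝ} (ht : t ∈ Set.Icc (0 : ℝ) 1)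
    (heq : pageDir n k = pageDir n (i + 1) * Complex.exp (((t * (3 * π / n) : ℝ) : ℂ) * Complex.I)) :
    False := by
  have hn : 0 < n := by omega
  rw [pageDir_mul_exp_ofReal] at heq
  obtain ⟨m, hm⟩ := exists_int_of_pageDir_eq hn k (i + 1) _ heq
  have hn' : (n : ℝ) ≠ 0 := by exact_mod_cast hn.ne'
  have h3 : 3 * t = 2 * (((i : ℤ) + 1 - k - n * m : ℤ) : ℝ) := by
    push_cast at hm ⊢
    field_simp at hm
    linarith
  have hk := k.2
  rcases int_zero_or_one (J := (i : ℤ) + 1 - k - n * m) (by linarith [ht.1]) (by linarith [ht.2]) with h0 | h1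
  · have hm0 := int_eq_zero_of_mul_eq (n := n) (m := m) (d := (i : ℤ) + 1 - k) (by linarith) (by omega) (by omega)
    subst hm0
    have e : ((k : ℕ) : ℤ) = i + 1 := by linarith [h0]
    exact hkB (Fin.ext (show (k : ℕ) = i + 1 by exact_mod_cast e))
  · have hm0 := int_eq_zero_of_mul_eq (n := n) (m := m) (d := (i : ℤ) - k) (by linarith) (by omega) (by omega)
    subst hm0
    have e : ((k : ℕ) : ℤ) = i := by linarith [h1]
    exact hkA (Fin.ext (show (k : ℕ) = i by exact_mod_cast e))

/-- Move 1: the crossed direction `pageDir n i` sits at parameter `2/3` of the arc. [folklore] -/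
theorem cross_move1 (hi : i + 1 < n) :
    pageDir n i = pageDir n (i + 1) * Complex.exp ((((2 / 3 : ℝ) * (3 * π / n) : ℝ) : ℂ) * Complex.I) := by
  have hn : (n : ℝ) ≠ 0 := Nat.cast_ne_zero.2 (by omega)
  rw [pageDir_mul_exp_ofReal, pageDir]
  congr 1; push_cast; field_simp; ring

/-- Move 2 (`up`): the turned direction of handle `i+1` is off the arc of move 2. [folklore] -/
theorem free_move2_B (hi : i + 1 < n) {t : ℝ} (ht : t ∈ Set.Icc (0 : ℝ) 1)
    (heq : pageDir n (i + 1) * Complex.exp (((3 * π / n : ℝ) : ℂ) * Complex.I) =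
      pageDir n i * Complex.exp (((t * -(2 * π / n) : ℝ) : ℂ) * Complex.I)) : False := by
  have hn : 0 < n := by omega
  have hn2 : 2 ≤ n := by omega
  rw [pageDir_mul_exp_ofReal, pageDir_mul_exp_ofReal, exp_mul_I_eq_iff] at heq
  obtain ⟨m, hm⟩ := heq
  have hn' : (n : ℝ) ≠ 0 := by exact_mod_cast hn.ne'
  have ht' : t = (((n : ℤ) * m : ℤ) : ℝ) - 1 / 2 := by
    field_simp at hm
    push_cast at hm ⊢
    have e2 : (2 : ℝ) * n * m = 2 * ((n : ℝ) * m) := by ring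
    linarith
  have h1 : ((n : ℤ) * m : ℤ) = 1 :=
    int_eq_one_of (P := (n : ℤ) * m) (by linarith [ht.1, ht.2]) (by linarith [ht.1, ht.2])
  exact int_mul_ne_of_two_le hn2 m 1 (Or.inl rfl) h1

/-- Move 2 (`up`): no unmoved direction on the arc of move 2. [folklore] -/
theorem free_move2_O (hi : i + 1 < n) (k : Fin n) (hkB : k ≠ ⟨i + 1, hi⟩)
    (hkA : k ≠ ⟨i, Nat.lt_of_succ_lt hi⟩) {t : ℝ} (ht : t ∈ Set.Icc (0 : ℝ) 1)
    (heq : pageDir n k = pageDir n i * Complex.exp (((t * -(2 * π / n) : ℝ) : ℂ) * Complex.I)) :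
    False := by
  have hn : 0 < n := by omega
  rw [pageDir_mul_exp_ofReal] at heq
  obtain ⟨m, hm⟩ := exists_int_of_pageDir_eq hn k i _ heq
  have hn' : (n : ℝ) ≠ 0 := by exact_mod_cast hn.ne'
  have ht' : t = (((k : ℤ) - i + n * m : ℤ) : ℝ) := by
    push_cast at hm ⊢
    field_simp at hm
    linarith
  have hk := k.2
  rcases int_zero_or_one (J := (k : ℤ) - i + n * m) (by linarith [ht.1]) (by linarith [ht.2]) with h0 | h1
  · have hm0 := int_eq_zero_of_mul_eq (n := n) (m := m) (d := (i : ℤ) - k) (by linarith) (by omega) (by omega)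
    subst hm0
    have e : ((k : ℕ) : ℤ) = i := by linarith [h0]
    exact hkA (Fin.ext (show (k : ℕ) = i by exact_mod_cast e))
  · have hm0 := int_eq_zero_of_mul_eq (n := n) (m := m) (d := (i : ℤ) + 1 - k) (by linarith) (by omega) (by omega)
    subst hm0
    have e : ((k : ℕ) : ℤ) = i + 1 := by linarith [h1]
    exact hkB (Fin.ext (show (k : ℕ) = i + 1 by exact_mod_cast e))

/-- Move 3 (`up`): the turned direction of handle `i` is off the arc of move 3. [folklore] -/
theorem free_move3_A (hi : i + 1 < n) {t : ℝ} (ht : t ∈ Set.Icc (0 : ℝ) 1)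
    (heq : pageDir n i * Complex.exp (((-(2 * π / n) : ℝ) : ℂ) * Complex.I) =
      pageDir n (i + 1) * Complex.exp (((3 * π / n : ℝ) : ℂ) * Complex.I) *
        Complex.exp (((t * -(π / n) : ℝ) : ℂ) * Complex.I)) : False := by
  have hn : 0 < n := by omega
  have hn2 : 2 ≤ n := by omega
  rw [pageDir_mul_exp_ofReal, pageDir_mul_exp_ofReal, ← Complex.exp_add, ← add_mul, ← Complex.ofReal_add,
    exp_mul_I_eq_iff] at heq
  obtain ⟨m, hm⟩ := heq
  have hn' : (n : ℝ) ≠ 0 := by exact_mod_cast hn.ne'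
  have ht' : t = 2 * (((n : ℤ) * m : ℤ) : ℝ) + 3 := by
    field_simp at hm
    push_cast at hm ⊢
    have e2 : (2 : ℝ) * n * m = 2 * ((n : ℝ) * m) := by ring
    linarith
  have h1 : ((n : ℤ) * m : ℤ) = -1 :=
    int_eq_neg_one_of (P := (n : ℤ) * m) (by linarith [ht.1, ht.2]) (by linarith [ht.1, ht.2])
  exact int_mul_ne_of_two_le hn2 m (-1) (Or.inr rfl) h1

/-- Move 3 (`up`): no unmoved direction on the arc of move 3. [folklore] -/
theorem free_move3_O (hi : i + 1 < n) (k : Fin n) (_hkB : k ≠ ⟨i + 1, hi⟩)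
    (hkA : k ≠ ⟨i, Nat.lt_of_succ_lt hi⟩) {t : ℝ} (ht : t ∈ Set.Icc (0 : ℝ) 1)
    (heq : pageDir n k = pageDir n (i + 1) * Complex.exp (((3 * π / n : ℝ) : ℂ) * Complex.I) *
        Complex.exp (((t * -(π / n) : ℝ) : ℂ) * Complex.I)) : False := by
  have hn : 0 < n := by omega
  rw [pageDir_mul_exp_ofReal, ← Complex.exp_add, ← add_mul, ← Complex.ofReal_add, add_assoc] at heq
  obtain ⟨m, hm⟩ := exists_int_of_pageDir_eq hn k (i + 1) _ heq
  have hn' : (n : ℝ) ≠ 0 := by exact_mod_cast hn.ne'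
  have ht' : t = 3 - 2 * ((((i : ℤ) + 1 - k - n * m : ℤ) : ℝ)) := by
    push_cast at hm ⊢
    field_simp at hm
    linarith
  have hk := k.2
  have hJ : (i : ℤ) + 1 - k - n * m = 1 :=
    int_eq_one_of (P := (i : ℤ) + 1 - k - n * m) (by linarith [ht.1, ht.2]) (by linarith [ht.1, ht.2])
  have hm0 := int_eq_zero_of_mul_eq (n := n) (m := m) (d := (i : ℤ) - k) (by linarith) (by omega) (by omega)
  subst hm0
  have e : ((k : ℕ) : ℤ) = i := by linarith [hJ]
  exact hkA (Fin.ext (show (k : ℕ) = i by exact_mod_cast e))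

/-- `pageDir n (i+1)` turned by `3π/n` then by `−π/n` is `pageDir n i`. [folklore] -/
theorem dir_move3 (hi : i + 1 < n) :
    pageDir n (i + 1) * Complex.exp (((3 * π / n : ℝ) : ℂ) * Complex.I) *
        Complex.exp (((-(π / n) : ℝ) : ℂ) * Complex.I) = pageDir n i := by
  have hn : (n : ℝ) ≠ 0 := Nat.cast_ne_zero.2 (by omega)
  rw [pageDir_mul_exp_ofReal, ← Complex.exp_add, pageDir]
  congr 1; push_cast; field_simp; ring

/-- `pageDir n i` turned by `−2π/n` is `pageDir n (i+1)`. [folklore] -/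
theorem dir_move2 (hi : i + 1 < n) :
    pageDir n i * Complex.exp (((-(2 * π / n) : ℝ) : ℂ) * Complex.I) = pageDir n (i + 1) := by
  have hn : (n : ℝ) ≠ 0 := Nat.cast_ne_zero.2 (by omega)
  rw [pageDir_mul_exp_ofReal, pageDir]
  congr 1; push_cast; field_simp; ring

/-- Move 1 (`¬up`): the arc from `pageDir n i` clockwise by `3π/n` is free. [folklore] -/
theorem free_move1' (hi : i + 1 < n) (k : Fin n) (hkA : k ≠ ⟨i, Nat.lt_of_succ_lt hi⟩)
    (hkB : k ≠ ⟨i + 1, hi⟩) {t : ℝ} (ht : t ∈ Set.Icc (0 : ℝ) 1)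
    (heq : pageDir n k = pageDir n i * Complex.exp (((t * -(3 * π / n) : ℝ) : ℂ) * Complex.I)) :
    False := by
  have hn : 0 < n := by omega
  rw [pageDir_mul_exp_ofReal] at heq
  obtain ⟨m, hm⟩ := exists_int_of_pageDir_eq hn k i _ heq
  have hn' : (n : ℝ) ≠ 0 := by exact_mod_cast hn.ne'
  have h3 : 3 * t = 2 * ((((k : ℤ) - i + n * m : ℤ)) : ℝ) := by
    push_cast at hm ⊢
    field_simp at hm
    linarith
  have hk := k.2
  rcases int_zero_or_one (J := (k : ℤ) - i + n * m) (by linarith [ht.1]) (by linarith [ht.2]) with h0 | h1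
  · have hm0 := int_eq_zero_of_mul_eq (n := n) (m := m) (d := (i : ℤ) - k) (by linarith) (by omega) (by omega)
    subst hm0
    have e : ((k : ℕ) : ℤ) = i := by linarith [h0]
    exact hkA (Fin.ext (show (k : ℕ) = i by exact_mod_cast e))
  · have hm0 := int_eq_zero_of_mul_eq (n := n) (m := m) (d := (i : ℤ) + 1 - k) (by linarith) (by omega) (by omega)
    subst hm0
    have e : ((k : ℕ) : ℤ) = i + 1 := by linarith [h1]
    exact hkB (Fin.ext (show (k : ℕ) = i + 1 by exact_mod_cast e))

/-- Move 1 (`¬up`): the crossed direction `pageDir n (i+1)` sits at parameter `2/3`. [folklore] -/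
theorem cross_move1' (hi : i + 1 < n) :
    pageDir n (i + 1) = pageDir n i * Complex.exp ((((2 / 3 : ℝ) * -(3 * π / n) : ℝ) : ℂ) * Complex.I) := by
  have hn : (n : ℝ) ≠ 0 := Nat.cast_ne_zero.2 (by omega)
  rw [pageDir_mul_exp_ofReal, pageDir]
  congr 1; push_cast; field_simp; ring

/-- Move 2 (`¬up`): the turned direction of handle `i` is off the arc of move 2. [folklore] -/
theorem free_move2_B' (hi : i + 1 < n) {t : ℝ} (ht : t ∈ Set.Icc (0 : ℝ) 1)
    (heq : pageDir n i * Complex.exp (((-(3 * π / n) : ℝ) : ℂ) * Complex.I) =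
      pageDir n (i + 1) * Complex.exp (((t * (2 * π / n) : ℝ) : ℂ) * Complex.I)) : False := by
  have hn : 0 < n := by omega
  have hn2 : 2 ≤ n := by omega
  rw [pageDir_mul_exp_ofReal, pageDir_mul_exp_ofReal, exp_mul_I_eq_iff] at heq
  obtain ⟨m, hm⟩ := heq
  have hn' : (n : ℝ) ≠ 0 := by exact_mod_cast hn.ne'
  have ht' : t = -(((n : ℤ) * m : ℤ) : ℝ) - 1 / 2 := by
    field_simp at hm
    push_cast at hm ⊢
    have e2 : (2 : ℝ) * n * m = 2 * ((n : ℝ) * m) := by ring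
    linarith
  have h1 : ((n : ℤ) * m : ℤ) = -1 :=
    int_eq_neg_one_of (P := (n : ℤ) * m) (by linarith [ht.1, ht.2]) (by linarith [ht.1, ht.2])
  exact int_mul_ne_of_two_le hn2 m (-1) (Or.inr rfl) h1

/-- Move 2 (`¬up`): no unmoved direction on the arc of move 2. [folklore] -/
theorem free_move2_O' (hi : i + 1 < n) (k : Fin n) (hkA : k ≠ ⟨i, Nat.lt_of_succ_lt hi⟩)
    (hkB : k ≠ ⟨i + 1, hi⟩) {t : ℝ} (ht : t ∈ Set.Icc (0 : ℝ) 1)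
    (heq : pageDir n k = pageDir n (i + 1) * Complex.exp (((t * (2 * π / n) : ℝ) : ℂ) * Complex.I)) :
    False := by
  have hn : 0 < n := by omega
  rw [pageDir_mul_exp_ofReal] at heq
  obtain ⟨m, hm⟩ := exists_int_of_pageDir_eq hn k (i + 1) _ heq
  have hn' : (n : ℝ) ≠ 0 := by exact_mod_cast hn.ne'
  have ht' : t = ((((i : ℤ) + 1 - k - n * m : ℤ)) : ℝ) := by
    push_cast at hm ⊢
    field_simp at hm
    linarith
  have hk := k.2
  rcases int_zero_or_one (J := (i : ℤ) + 1 - k - n * m) (by linarith [ht.1]) (by linarith [ht.2]) with h0 | h1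
  · have hm0 := int_eq_zero_of_mul_eq (n := n) (m := m) (d := (i : ℤ) + 1 - k) (by linarith) (by omega) (by omega)
    subst hm0
    have e : ((k : ℕ) : ℤ) = i + 1 := by linarith [h0]
    exact hkB (Fin.ext (show (k : ℕ) = i + 1 by exact_mod_cast e))
  · have hm0 := int_eq_zero_of_mul_eq (n := n) (m := m) (d := (i : ℤ) - k) (by linarith) (by omega) (by omega)
    subst hm0
    have e : ((k : ℕ) : ℤ) = i := by linarith [h1]
    exact hkA (Fin.ext (show (k : ℕ) = i by exact_mod_cast e))

/-- Move 3 (`¬up`): the turned direction of handle `i+1` is off the arc of move 3. [folklore] -/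
theorem free_move3_A' (hi : i + 1 < n) {t : ℝ} (ht : t ∈ Set.Icc (0 : ℝ) 1)
    (heq : pageDir n (i + 1) * Complex.exp (((2 * π / n : ℝ) : ℂ) * Complex.I) =
      pageDir n i * Complex.exp (((-(3 * π / n) : ℝ) : ℂ) * Complex.I) *
        Complex.exp (((t * (π / n) : ℝ) : ℂ) * Complex.I)) : False := by
  have hn : 0 < n := by omega
  have hn2 : 2 ≤ n := by omega
  rw [pageDir_mul_exp_ofReal, pageDir_mul_exp_ofReal, ← Complex.exp_add, ← add_mul, ← Complex.ofReal_add,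
    exp_mul_I_eq_iff] at heq
  obtain ⟨m, hm⟩ := heq
  have hn' : (n : ℝ) ≠ 0 := by exact_mod_cast hn.ne'
  have ht' : t = 3 - 2 * (((n : ℤ) * m : ℤ) : ℝ) := by
    field_simp at hm
    push_cast at hm ⊢
    have e2 : (2 : ℝ) * n * m = 2 * ((n : ℝ) * m) := by ring
    linarith
  have h1 : ((n : ℤ) * m : ℤ) = 1 :=
    int_eq_one_of (P := (n : ℤ) * m) (by linarith [ht.1, ht.2]) (by linarith [ht.1, ht.2])
  exact int_mul_ne_of_two_le hn2 m 1 (Or.inl rfl) h1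

/-- Move 3 (`¬up`): no unmoved direction on that arc. [folklore] -/
theorem free_move3_O' (hi : i + 1 < n) (k : Fin n) (_hkA : k ≠ ⟨i, Nat.lt_of_succ_lt hi⟩)
    (hkB : k ≠ ⟨i + 1, hi⟩) {t : ℝ} (ht : t ∈ Set.Icc (0 : ℝ) 1)
    (heq : pageDir n k = pageDir n i * Complex.exp (((-(3 * π / n) : ℝ) : ℂ) * Complex.I) *
        Complex.exp (((t * (π / n) : ℝ) : ℂ) * Complex.I)) : False := by
  have hn : 0 < n := by omega
  rw [pageDir_mul_exp_ofReal, ← Complex.exp_add, ← add_mul, ← Complex.ofReal_add, add_assoc] at heq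
  obtain ⟨m, hm⟩ := exists_int_of_pageDir_eq hn k i _ heq
  have hn' : (n : ℝ) ≠ 0 := by exact_mod_cast hn.ne'
  have ht' : t = 3 + 2 * ((((i : ℤ) - k - n * m : ℤ) : ℝ)) := by
    push_cast at hm ⊢
    field_simp at hm
    linarith
  have hk := k.2
  have hJ : (i : ℤ) - k - n * m = -1 :=
    int_eq_neg_one_of (P := (i : ℤ) - k - n * m) (by linarith [ht.1, ht.2]) (by linarith [ht.1, ht.2])
  have hm0 := int_eq_zero_of_mul_eq (n := n) (m := m) (d := (i : ℤ) + 1 - k) (by linarith) (by omega) (by omega)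
  subst hm0
  have e : ((k : ℕ) : ℤ) = i + 1 := by linarith [hJ]
  exact hkB (Fin.ext (show (k : ℕ) = i + 1 by exact_mod_cast e))

/-- The final direction of handle `i` (`¬up`). [folklore] -/
theorem dir_move3' (hi : i + 1 < n) :
    pageDir n i * Complex.exp (((-(3 * π / n) : ℝ) : ℂ) * Complex.I) *
        Complex.exp (((π / n : ℝ) : ℂ) * Complex.I) = pageDir n (i + 1) := by
  have hn : (n : ℝ) ≠ 0 := Nat.cast_ne_zero.2 (by omega)
  rw [pageDir_mul_exp_ofReal, ← Complex.exp_add, pageDir]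
  congr 1; push_cast; field_simp; ring

/-- The final direction of handle `i+1` (`¬up`). [folklore] -/
theorem dir_move2' (hi : i + 1 < n) :
    pageDir n (i + 1) * Complex.exp (((2 * π / n : ℝ) : ℂ) * Complex.I) = pageDir n i := by
  have hn : (n : ℝ) ≠ 0 := Nat.cast_ne_zero.2 (by omega)
  rw [pageDir_mul_exp_ofReal, pageDir]
  congr 1; push_cast; field_simp; ring

end HurwitzMove

open HurwitzMove in
/-- **Reading an equation between a page direction and a shifted page direction**, registered form
(sub-goal `helper_exists_int_of_pageDir_eq` of `stub_M2geo`): `pageDir n k = e^{i(θ_j + c)}` with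
`θ_j = −2π(j+½)/n` forces `c n / 2π = j − k − n m` for an integer `m`. [folklore] -/
theorem helper_exists_int_of_pageDir_eq : ∀ (n : ℕ), 0 < n → ∀ (k j : ℕ) (c : ℝ), Literature.Topology.FourManifolds.LefschetzBase.pageDir n k = Complex.exp (((-(2 * Real.pi * (j + 1 / 2) / n) + c : ℝ) : ℂ) * Complex.I) → ∃ m : ℤ, c * n / (2 * Real.pi) = (j : ℝ) - k - n * m :=
  fun _ hn k j c h => exists_int_of_pageDir_eq hn k j c h

end Summit.SmoothPoincare4.SmoothPoincare4.Theorems.AcyclicBisectionExists.ModpBraidOrbits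

end
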